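import Literature.IUT.HodgeTheaters.SurfaceGroupFiniteIndexBridge
import Literature.IUT.HodgeTheaters.ProfiniteCompletionQuotients
import Literature.GroupTheory.CombinatorialGroupTheory.SurfaceGroupFiniteIndexSubgroupHolds
import Literature.GroupTheory.CombinatorialGroupTheory.FreeGroupCompletionTorsionFree
import Mathlib.GroupTheory.Index
import Mathlib.GroupTheory.OrderOfElement
import Mathlib.Data.ZMod.Basic
import Mathlib.Algebra.Group.TypeTags.Finite
import HarnessLib

/-!
# The profinite completion of an orientable surface group is torsion-free

Mochizuki, *Inter-universal Teichmüller theory I*, kurims manuscript (May 2020), §2, proof of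
Lemma 2.7 (vi), p. 59: *"Since [as is well-known] the abelianizations of all open subgroups of `Ĝ`
are torsion-free, we thus conclude that `Z_Ĝ(N̂) = {1}`"* [cite: Mochizuki2012, Lem 2.7(vi) p.59]
(D-0012 claim key, status disputed — the content here is plain profinite group theory and takes no
side).  What that sentence is used for is exactly: an element of finite order of `Ĝ` is trivial.  The
free half is `IsFreeGroup.eq_one_of_pow_eq_one_profiniteCompletion`
(`CombinatorialGroupTheory/FreeGroupCompletionTorsionFree.lean`); this proof-only companion gives the
ORIENTABLE-SURFACE-GROUP half (node IUTchI:Lem2.7(vi), printed route), by the same componentwise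
argument, UNCONDITIONALLY: the only input beyond Mathlib is the tree's theorem
`surfaceGroupFiniteIndexSubgroup_holds` (F_cov: a finite-index subgroup of `S_g` is an `S_h`,
Zieschang–Vogt–Coldewey 4.14.22/23), through the bridge
`IsOrientableSurfaceGroup.subgroup_of_finiteIndex`.

Proof (as in the free case; no cohomological dimension).  Let `z ∈ Ĝ`, `z ^ m = 1`, `m > 0`, fix a
level `N₀` and put `a := z(N₀) ∈ G ⧸ N₀`, of order `c`.  The preimage `H ≤ G` of `⟨a⟩` has finite
index, so it is an orientable surface group `S_h`; a homomorphism from the one-relator group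
`S_h = ⟨a_i, b_i ∣ ∏ [a_i, b_i]⟩` to the CYCLIC group `⟨a⟩` lifts through `ℤ` (choose integer exponents
on the generators; the relator is a product of commutators, so it dies in `ℤ`): `θ(h) = a ^ σ(h)`,
`σ : H → ℤ` (`exists_hom_int_zpow_of_isOrientableSurfaceGroup`).  With `K := Ker(H → ℤ → ℤ/mc)` and
`N :=` the normal core of `N₀ ∩ K`, writing `z(N) = f·N` gives `f ∈ H`, `f ^ m ∈ N ≤ K`, so
`mc ∣ m σ(f)`, `c ∣ σ(f)`, and `a = θ(f) = a ^ σ(f) = 1`.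

Main results: `IsOrientableSurfaceGroup.eq_one_of_pow_eq_one_profiniteCompletion` and the combined
`FreeOrSurface.eq_one_of_pow_eq_one_profiniteCompletion` / `FreeOrSurface.isOfFinOrder_iff_eq_one`
for "a group as in Theorem 2.6".  Theorems only; no statement of the tree is restated.
-/

namespace Literature.IUT.HodgeTheaters

open CategoryTheory ProfiniteGrp Literature.GroupTheory.CombinatorialGroupTheory

universe u

variable {G : Type u} [Group G]

/-! ### Homomorphisms from a surface group to a cyclic group lift through `ℤ` -/

/-- The surface relator `∏_{i<g} [a_i, b_i]` dies under every homomorphism to a commutative group.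
[cite: Mochizuki2012, Thm 2.6 p.56] -/
theorem surfaceRelator_lift_eq_one_of_commGroup {A : Type*} [CommGroup A] (g : ℕ) (f : Fin g ⊕ Fin g → A) :
    FreeGroup.lift f (surfaceRelator g) = 1 := by
  rw [surfaceRelator, map_list_prod, List.map_map]
  apply List.prod_eq_one
  intro x hx
  rw [List.mem_map] at hx
  obtain ⟨i, -, rfl⟩ := hx
  simp only [Function.comp_apply, map_mul, map_inv, FreeGroup.lift_apply_of]
  rw [mul_inv_eq_one, mul_inv_eq_iff_eq_mul, mul_comm]

/-- A homomorphism from the surface group `S_g = ⟨a_i, b_i ∣ ∏ [a_i, b_i]⟩` to any group whose image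
lies in a cyclic subgroup `⟨a⟩` lifts through the integers: `θ(h) = a ^ σ(h)` for a homomorphism
`σ : S_g → ℤ` (choose exponents on the generators; the relator maps to `0 ∈ ℤ`) — the use of "the
abelianization of [a surface group] is torsion-free" on p. 59. [cite: Mochizuki2012, Lem 2.7(vi) p.59] -/
theorem SurfaceGroup.exists_hom_int_zpow {Q : Type*} [Group Q] (g : ℕ) (θ : SurfaceGroup g →* Q)
    (a : Q) (hθ : ∀ h, θ h ∈ Subgroup.zpowers a) :
    ∃ σ : SurfaceGroup g →* Multiplicative ℤ, ∀ h, θ h = a ^ Multiplicative.toAdd (σ h) := by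
  classical
  have hk : ∀ s : Fin g ⊕ Fin g, ∃ k : ℤ, a ^ k = θ (PresentedGroup.of s) := fun s =>
    Subgroup.mem_zpowers_iff.mp (hθ _)
  choose k hk using hk
  let f : Fin g ⊕ Fin g → Multiplicative ℤ := fun s => Multiplicative.ofAdd (k s)
  have hf : ∀ r ∈ ({surfaceRelator g} : Set (FreeGroup (Fin g ⊕ Fin g))), FreeGroup.lift f r = 1 := by
    intro r hr
    rw [Set.mem_singleton_iff] at hr
    subst hr
    exact surfaceRelator_lift_eq_one_of_commGroup g f
  refine ⟨PresentedGroup.toGroup hf, fun h => ?_⟩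
  have key : θ = (zpowersHom Q a).comp (PresentedGroup.toGroup hf) := by
    refine PresentedGroup.ext fun s => ?_
    rw [MonoidHom.comp_apply, PresentedGroup.toGroup.of, zpowersHom_apply, toAdd_ofAdd, hk s]
  conv_lhs => rw [key]
  rfl

/-- The same lifting for an abstract orientable surface group `H ≅ S_g`: a homomorphism `θ : H → Q`
with image in a cyclic subgroup `⟨a⟩` is `h ↦ a ^ σ(h)` for some `σ : H → ℤ`.  (This is the use of
"the abelianization of [an orientable surface group] is torsion-free", p. 59.)
[cite: Mochizuki2012, Lem 2.7(vi) p.59] -/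
theorem IsOrientableSurfaceGroup.exists_hom_int_zpow {H : Type u} [Group H] {Q : Type*} [Group Q]
    (hH : IsOrientableSurfaceGroup H) (θ : H →* Q) (a : Q) (hθ : ∀ h, θ h ∈ Subgroup.zpowers a) :
    ∃ σ : H →* Multiplicative ℤ, ∀ h, θ h = a ^ Multiplicative.toAdd (σ h) := by
  obtain ⟨g, -, ⟨e⟩⟩ := hH
  obtain ⟨σ₀, hσ₀⟩ :=
    SurfaceGroup.exists_hom_int_zpow g (θ.comp e.symm.toMonoidHom) a fun h => hθ _
  refine ⟨σ₀.comp e.toMonoidHom, fun h => ?_⟩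
  have := hσ₀ (e h)
  rw [MonoidHom.comp_apply, MulEquiv.coe_toMonoidHom, MulEquiv.symm_apply_apply] at this
  rw [this]
  rfl

/-! ### Torsion-freeness of `Ĝ` for an orientable surface group `G` -/

/-- Components of powers in `Ĝ = lim G ⧸ N` (plumbing for "`z ^ m = 1` componentwise", p. 59).
[cite: Mochizuki2012, Lem 2.7(vi) p.59] -/
theorem ProfiniteCompletion.pow_val (x : profiniteCompletion G) (N : FiniteIndexNormalSubgroup G)
    (m : ℕ) : (x ^ m).val N = (x.val N) ^ m := by
  induction m with
  | zero => rfl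
  | succ m ih => rw [pow_succ, pow_succ, ← ih]; rfl

/-- **The profinite completion of an orientable surface group is torsion-free, GRANTED F_cov**: for
`G` an orientable surface group, `z ∈ Ĝ` with `z ^ m = 1`, `m > 0`, one has `z = 1` — relative to the
named fact `SurfaceGroupFiniteIndexSubgroup` (finite-index subgroups of `S_g` are surface groups), used
once, to know that the preimage `H` of the cyclic group `⟨z(N₀)⟩` is again an orientable surface group.
This is what the proof of Lemma 2.7 (vi) uses under the words *"the abelianizations of all open
subgroups of `Ĝ` are torsion-free"*. [cite: Mochizuki2012, Lem 2.7(vi) p.59] -/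
theorem IsOrientableSurfaceGroup.eq_one_of_pow_eq_one_profiniteCompletion_of_finiteIndexSubgroup
    (hF : SurfaceGroupFiniteIndexSubgroup) (hG : IsOrientableSurfaceGroup G)
    (z : profiniteCompletion G) {m : ℕ} (hm : 0 < m) (hz : z ^ m = 1) : z = 1 := by
  classical
  apply Subtype.ext
  funext N₀
  change z.val N₀ = 1
  -- `a := z(N₀)`, `H :=` its preimage `≤ G`
  set a : G ⧸ N₀.toSubgroup := z.val N₀ with ha
  let H : Subgroup G := (Subgroup.zpowers a).comap (QuotientGroup.mk' N₀.toSubgroup)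
  have hN₀H : N₀.toSubgroup ≤ H := fun n hn => by
    change QuotientGroup.mk' N₀.toSubgroup n ∈ Subgroup.zpowers a
    rw [QuotientGroup.mk'_apply, (QuotientGroup.eq_one_iff n).mpr hn]
    exact one_mem _
  haveI hHfi : H.FiniteIndex := by
    constructor
    rw [Subgroup.index_comap_of_surjective _ (QuotientGroup.mk'_surjective _)]
    exact Subgroup.FiniteIndex.index_ne_zero
  -- `H` is an orientable surface group (F_cov, the only use)
  have hHsurf : IsOrientableSurfaceGroup H := hG.subgroup_of_finiteIndex hF H
  -- `θ : H → ⟨a⟩` and its integral lift `σ`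
  let θ : H →* G ⧸ N₀.toSubgroup := (QuotientGroup.mk' N₀.toSubgroup).comp H.subtype
  have hθ : ∀ h : H, θ h ∈ Subgroup.zpowers a := fun h => h.2
  obtain ⟨σ, hσ⟩ := hHsurf.exists_hom_int_zpow θ a hθ
  -- `c := ord a`, `K := Ker(H → ℤ/mc)`, `N := core(N₀ ∩ K)`
  set c : ℕ := orderOf a with hc
  have hc0 : 0 < c := (isOfFinOrder_of_finite a).orderOf_pos
  haveI : NeZero (m * c) := ⟨Nat.pos_iff_ne_zero.mp (Nat.mul_pos hm hc0)⟩
  let χ : Multiplicative ℤ →* Multiplicative (ZMod (m * c)) :=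
    AddMonoidHom.toMultiplicative (Int.castAddHom (ZMod (m * c)))
  let K : Subgroup H := (χ.comp σ).ker
  haveI : Finite (χ.comp σ).range := inferInstance
  haveI hKfi : K.FiniteIndex := Subgroup.finiteIndex_ker _
  let L : Subgroup G := N₀.toSubgroup ⊓ K.map H.subtype
  haveI hLfi : L.FiniteIndex := by
    haveI : (K.map H.subtype).FiniteIndex := by
      constructor
      rw [Subgroup.index_map, H.ker_subtype, sup_bot_eq, H.range_subtype]
      exact mul_ne_zero hKfi.index_ne_zero hHfi.index_ne_zero
    infer_instance
  let N : FiniteIndexNormalSubgroup G := FiniteIndexNormalSubgroup.ofSubgroup L.normalCore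
  have hNL : N.toSubgroup ≤ L := Subgroup.normalCore_le L
  have hNN₀ : N ≤ N₀ := fun g hg => (Subgroup.mem_inf.mp (hNL hg)).1
  -- a representative `f` of `z(N)`; coherence: `f·N₀ = a`, so `f ∈ H`
  obtain ⟨f, hf⟩ := QuotientGroup.mk_surjective (z.val N)
  have hfN₀ : (QuotientGroup.mk f : G ⧸ N₀.toSubgroup) = a :=
    (ProfiniteCompletion.val_mk_eq_of_le z hNN₀ f hf.symm).symm
  have hfH : f ∈ H := by
    change QuotientGroup.mk' N₀.toSubgroup f ∈ Subgroup.zpowers a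
    rw [QuotientGroup.mk'_apply, hfN₀]
    exact Subgroup.mem_zpowers a
  -- `z^m = 1` gives `f^m ∈ N ≤ K`
  have hzN : (z.val N) ^ m = 1 := by
    have h : (z ^ m).val N = (1 : profiniteCompletion G).val N := by rw [hz]
    rw [ProfiniteCompletion.pow_val] at h
    exact h
  have hfm : f ^ m ∈ N.toSubgroup := by
    rw [← QuotientGroup.eq_one_iff, QuotientGroup.mk_pow, hf]
    exact hzN
  have hfmK : (⟨f, hfH⟩ : H) ^ m ∈ K := by
    have h1 : f ^ m ∈ K.map H.subtype := (Subgroup.mem_inf.mp (hNL hfm)).2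
    obtain ⟨k, hk, hkf⟩ := Subgroup.mem_map.mp h1
    have : k = ⟨f, hfH⟩ ^ m := Subtype.ext (by simpa using hkf)
    rw [← this]; exact hk
  -- hence `mc ∣ m σ(f)`, `c ∣ σ(f)`, `a ^ σ(f) = 1`
  set s : ℤ := Multiplicative.toAdd (σ ⟨f, hfH⟩) with hs
  have hdiv : ((m * c : ℕ) : ℤ) ∣ (m : ℤ) * s := by
    have h1 : (χ.comp σ) (⟨f, hfH⟩ ^ m) = 1 := hfmK
    rw [_root_.map_pow, MonoidHom.comp_apply] at h1
    have h2 : (((m : ℤ) * s : ℤ) : ZMod (m * c)) = 0 := by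
      have h3 := congrArg Multiplicative.toAdd h1
      rw [toAdd_pow, toAdd_one] at h3
      have h4 : Multiplicative.toAdd (χ (σ ⟨f, hfH⟩)) = ((s : ℤ) : ZMod (m * c)) := rfl
      rw [h4, nsmul_eq_mul] at h3
      push_cast
      exact h3
    exact (ZMod.intCast_zmod_eq_zero_iff_dvd _ _).mp h2
  have hcs : (c : ℤ) ∣ s := by
    have : ((m : ℤ) * c) ∣ (m : ℤ) * s := by exact_mod_cast hdiv
    exact Int.dvd_of_mul_dvd_mul_left (by exact_mod_cast hm.ne') this
  have has : a ^ s = 1 := orderOf_dvd_iff_zpow_eq_one.mp (by rw [← hc]; exact hcs)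
  -- `a = θ(f) = a ^ σ(f) = 1`
  have hθf : θ ⟨f, hfH⟩ = a := by
    change QuotientGroup.mk' N₀.toSubgroup f = a
    rw [QuotientGroup.mk'_apply, hfN₀]
  have hfin : a = 1 := by rw [← hθf, hσ ⟨f, hfH⟩, ← hs, has]
  exact hfin

/-- **The profinite completion of an orientable surface group is torsion-free** (UNCONDITIONAL: F_cov is
the tree's theorem `surfaceGroupFiniteIndexSubgroup_holds`): `z ∈ Ĝ`, `z ^ m = 1`, `m > 0` imply
`z = 1`. [cite: Mochizuki2012, Lem 2.7(vi) p.59] -/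
theorem IsOrientableSurfaceGroup.eq_one_of_pow_eq_one_profiniteCompletion
    (hG : IsOrientableSurfaceGroup G) (z : profiniteCompletion G) {m : ℕ} (hm : 0 < m)
    (hz : z ^ m = 1) : z = 1 :=
  hG.eq_one_of_pow_eq_one_profiniteCompletion_of_finiteIndexSubgroup
    surfaceGroupFiniteIndexSubgroup_holds z hm hz

/-- **Torsion-freeness of `Ĝ` for "a group as in Theorem 2.6"** (free of finite rank or an orientable
surface group): `z ^ m = 1`, `m > 0` imply `z = 1`.  Free half:
`IsFreeGroup.eq_one_of_pow_eq_one_profiniteCompletion`. [cite: Mochizuki2012, Lem 2.7(vi) p.59] -/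
theorem FreeOrSurface.eq_one_of_pow_eq_one_profiniteCompletion (hG : IsFreeOrSurface G)
    (z : profiniteCompletion G) {m : ℕ} (hm : 0 < m) (hz : z ^ m = 1) : z = 1 := by
  rcases hG with hfree | hsurf
  · obtain ⟨n, ⟨e⟩⟩ := hfree
    haveI : IsFreeGroup G := IsFreeGroup.ofMulEquiv e.symm
    exact IsFreeGroup.eq_one_of_pow_eq_one_profiniteCompletion z hm hz
  · exact hsurf.eq_one_of_pow_eq_one_profiniteCompletion z hm hz

/-- Order form: for `G` free of finite rank or an orientable surface group, an element of `Ĝ` has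
finite order iff it is trivial. [cite: Mochizuki2012, Lem 2.7(vi) p.59] -/
theorem FreeOrSurface.isOfFinOrder_iff_eq_one (hG : IsFreeOrSurface G) (z : profiniteCompletion G) :
    IsOfFinOrder z ↔ z = 1 := by
  refine ⟨fun h => ?_, fun h => h ▸ IsOfFinOrder.one⟩
  obtain ⟨m, hm, hzm⟩ := h.exists_pow_eq_one
  exact FreeOrSurface.eq_one_of_pow_eq_one_profiniteCompletion hG z hm hzm

end Literature.IUT.HodgeTheaters
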